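import Mathlib.Tactic.Ring
import Mathlib.Tactic.LinearCombination
import HarnessLib

/-!
# [OURS · L1 W4.5(b) · EL♮(3)] Specimen 𝔅_{6,1} — CANDIDATE ISO CUSTOMER #1: chart identities behind the kit B6C-KIT (lead-1 g23) and the node walks
# (crit-3 LEVER 4 `ISO-Q-alpha-crit3.md` §5; idea-3 ISO-HUNT (16.15)(c)/(h′)/(h‴); crit-2 (20) `BisCharts.lean`; desk R92/R95; crux `EquisingularLiftNatThree`,
# stmt-ResolutionOfSingularities-20148)

NOT a statement of any manuscript; OURS kernel specimen.  AI-written, weaker than expert review.  Nothing of [Hironaka2017] is asserted; EL♮(3) is NOT proved here;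
door membership of 𝔅 is the panel's by-letters business.  This file certifies ONLY polynomial identities: (A) the «sum of two squares» shape of the strict transform
`T′ = (S² − B′)² + ε²R′` near the stuck points `z_i` (chart `ε = G′/(S − A′)`), which is why the tangent cone there is a pair of conics and why `T′` is formally two
A₁-cone sheets; (B) the charts of the PRE-RESOLVED local word at a node (idea-2's (U2a), idea-3 (h‴), memo B6C-KIT §3b) on the local node model
`T̃₁ = ((xy + a·z)² − z²·ℓℓ′)² + r·z⁶`, `ℓℓ′ = (n₁x + n₂y)(m₁x + m₂y)`, `Π = {z = 0}`: point step at the node (x-chart and z-chart), PAIR round of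
`ℓ′ = E_x ∩ St Π`, hosted round of the section `m`, and the formal splitting `Φ² + r z⁶ = (Φ + γz³)(Φ − γz³)` for `γ² = −r`.  Everything is `ring` /
`linear_combination` over an arbitrary commutative ring; the geometry (multiplicities, singular loci, END) is in the memo and the kits (j333398, j333427, j333443,
j333566), not here.  `--supports stmt-ResolutionOfSingularities-20148 --as helper`; def-free; standard axioms.
-/

set_option linter.dupNamespace false -- mandated namespace `Summit.<Summit>.<Problem>` of this single-conjunct summit

namespace Summit.ResolutionOfSingularities.ResolutionOfSingularities.Cruxes.EquisingularLiftNat.Sections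

namespace SpecimenB61

variable {R : Type} [CommRing R]

/-- [OURS · L1 W4.5b] (A1) Clearing the chart denominator near `z_i`: with `ε·(S − A) = G` on the chart `{G + εA = εS}`,
`(S − A)²·((S² − B)² + ε²·r) = ((S − A)(S² − B))² + r·G²` — the local equation `T″ = X₁² + r·X₂²`, `X₁ = (S − A)(S² − B)`, `X₂ = G`. [folklore] -/
theorem clear_denominator (S A B G e r : R) (h : e * (S - A) = G) :
    (S - A) ^ 2 * ((S ^ 2 - B) ^ 2 + e ^ 2 * r) = ((S - A) * (S ^ 2 - B)) ^ 2 + r * G ^ 2 := by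
  rw [← h]; ring

/-- [OURS · L1 W4.5b] (A2) Sum of two squares splits formally: if `j² = −r` then `X₁² + r·X₂² = (X₁ + j·X₂)·(X₁ − j·X₂)` — the two sheets
`(S − A)(S² − B) = ∓ j·G` of `T′` near `z_i` (each an A₁ cone there), crossing along `D = {G = 0, S² = B}`. [folklore] -/
theorem sum_of_squares_split (X₁ X₂ r j : R) (hj : j ^ 2 = -r) :
    X₁ ^ 2 + r * X₂ ^ 2 = (X₁ + j * X₂) * (X₁ - j * X₂) := by
  linear_combination (X₂ ^ 2) * hj

/-- [OURS · L1 W4.5b] (A3) The tangent cone at `z_i` splits the same way: `a²·X² + r·Y² = (a·X + j·Y)·(a·X − j·Y)` for `j² = −r`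
(`X = S² − ℓℓ′`, `Y = q_G`: the quartic cone `Q₄ = C₊·C₋`, two conics through the four branch directions `{q_G = 0, S² = ℓℓ′}`). [folklore] -/
theorem tangent_cone_split (a X Y r j : R) (hj : j ^ 2 = -r) :
    a ^ 2 * X ^ 2 + r * Y ^ 2 = (a * X + j * Y) * (a * X - j * Y) := by
  linear_combination (Y ^ 2) * hj

/-- [OURS · L1 W4.5b] (B1) Node model, point step at the node, x-chart (`y ↦ x·y₁`, `z ↦ x·z₁`):
`((x·xy₁ + a·xz₁)² − (xz₁)²·ℓℓ′(x, xy₁))² + r·(xz₁)⁶ = x⁴·( ((xy₁ + az₁)² − x²z₁²·L)² + r·x²z₁⁶ )` with `L = (n₁ + n₂y₁)(m₁ + m₂y₁)`: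
strict transform `T¹ = ((xy₁ + az₁)² − x²z₁²L)² + r x²z₁⁶`, multiplicity 4 at the node. [folklore] -/
theorem node_pointstep_chart_x (x y₁ z₁ a r n₁ n₂ m₁ m₂ : R) :
    ((x * (x * y₁) + a * (x * z₁)) ^ 2 - (x * z₁) ^ 2 * ((n₁ * x + n₂ * (x * y₁)) * (m₁ * x + m₂ * (x * y₁)))) ^ 2 + r * (x * z₁) ^ 6
      = x ^ 4 * (((x * y₁ + a * z₁) ^ 2 - x ^ 2 * z₁ ^ 2 * ((n₁ + n₂ * y₁) * (m₁ + m₂ * y₁))) ^ 2 + r * x ^ 2 * z₁ ^ 6) := by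
  ring

/-- [OURS · L1 W4.5b] (B2) On the exceptional plane `E_x = {x = 0}` the strict transform of (B1) is `(a·z₁)⁴`: `E_x ∩ T¹ = ℓ′ := {x = z₁ = 0} = E_x ∩ St Π`, FOUR-fold. [folklore] -/
theorem node_pointstep_on_Ex (y₁ z₁ a r L : R) :
    (((0 : R) * y₁ + a * z₁) ^ 2 - (0 : R) ^ 2 * z₁ ^ 2 * L) ^ 2 + r * (0 : R) ^ 2 * z₁ ^ 6 = a ^ 4 * z₁ ^ 4 := by
  ring

/-- [OURS · L1 W4.5b] (B3) Node model, point step, z-chart (`x ↦ z·x₁`, `y ↦ z·y₁`): `((zx₁·zy₁ + az)² − z²·ℓℓ′(zx₁, zy₁))² + r·z⁶ = z⁴·( ((z·x₁y₁ + a)² − z²·ℓℓ′(x₁,y₁))² + r·z² )`;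
at `z = 0` the bracket is `a⁴ ≠ 0`: the strict transform misses `E ∩ (z-chart)`. [folklore] -/
theorem node_pointstep_chart_z (z x₁ y₁ a r n₁ n₂ m₁ m₂ : R) :
    ((z * x₁ * (z * y₁) + a * z) ^ 2 - z ^ 2 * ((n₁ * (z * x₁) + n₂ * (z * y₁)) * (m₁ * (z * x₁) + m₂ * (z * y₁)))) ^ 2 + r * z ^ 6
      = z ^ 4 * (((z * (x₁ * y₁) + a) ^ 2 - z ^ 2 * ((n₁ * x₁ + n₂ * y₁) * (m₁ * x₁ + m₂ * y₁))) ^ 2 + r * z ^ 2) := by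
  ring

/-- [OURS · L1 W4.5b] (B4) PAIR round of `ℓ′ = {x = z₁ = 0}`, chart `z₁ ↦ x·z₂`, with `w₂ := y₁ + a·z₂`:
`((xy₁ + a·xz₂)² − x²(xz₂)²L)² + r·x²(xz₂)⁶ = x⁴·( (w₂² − x²z₂²L)² + r·x⁴z₂⁶ )` — strict transform `T² = (w₂² − x²z₂²L)² + r x⁴z₂⁶`, FOUR-fold along the section
`m = {x = 0, w₂ = 0}` of `E_ℓ′ → ℓ′`. [folklore] -/
theorem ellprime_round_chart (x y₁ z₂ a r L : R) :
    ((x * y₁ + a * (x * z₂)) ^ 2 - x ^ 2 * (x * z₂) ^ 2 * L) ^ 2 + r * x ^ 2 * (x * z₂) ^ 6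
      = x ^ 4 * (((y₁ + a * z₂) ^ 2 - x ^ 2 * z₂ ^ 2 * L) ^ 2 + r * x ^ 4 * z₂ ^ 6) := by
  ring

/-- [OURS · L1 W4.5b] (B5) Hosted round of the section `m = {x = 0, w₂ = 0}`, chart `w₂ ↦ x·w₃`:
`((x·w₃)² − x²z₂²L)² + r·x⁴z₂⁶ = x⁴·( (w₃² − z₂²L)² + r·z₂⁶ )` — strict transform `T³ = Φ² + r z₂⁶`, `Φ = w₃² − z₂²L`. [folklore] -/
theorem m_round_chart (x w₃ z₂ r L : R) :
    ((x * w₃) ^ 2 - x ^ 2 * z₂ ^ 2 * L) ^ 2 + r * x ^ 4 * z₂ ^ 6 = x ^ 4 * ((w₃ ^ 2 - z₂ ^ 2 * L) ^ 2 + r * z₂ ^ 6) := by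
  ring

/-- [OURS · L1 W4.5b] (B6) Formal splitting of `T³`: if `γ² = −r` then `Φ² + r·z₂⁶ = (Φ + γ·z₂³)·(Φ − γ·z₂³)`. [folklore] -/
theorem T3_split (Φ z₂ r γ : R) (hγ : γ ^ 2 = -r) :
    Φ ^ 2 + r * z₂ ^ 6 = (Φ + γ * z₂ ^ 3) * (Φ - γ * z₂ ^ 3) := by
  linear_combination (z₂ ^ 6) * hγ

/-- [OURS · L1 W4.5b] (B7) The two sheets of (B6) are `g_∓ = w₃² − z₂²·(L ∓ γ·z₂)`: `(w₃² − z₂²L) ± γ z₂³ = w₃² − z₂²(L ∓ γ z₂)` — each `w₃² = z₂²·unit`,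
an ordinary double surface along `N = {w₃ = z₂ = 0}` = the strict transform of the Z₁-branch, and nothing else. [folklore] -/
theorem T3_sheet (w₃ z₂ L γ : R) :
    (w₃ ^ 2 - z₂ ^ 2 * L) + γ * z₂ ^ 3 = w₃ ^ 2 - z₂ ^ 2 * (L - γ * z₂) ∧
    (w₃ ^ 2 - z₂ ^ 2 * L) - γ * z₂ ^ 3 = w₃ ^ 2 - z₂ ^ 2 * (L + γ * z₂) := by
  constructor <;> ring

end SpecimenB61

end Summit.ResolutionOfSingularities.ResolutionOfSingularities.Cruxes.EquisingularLiftNat.Sections
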